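import Mathlib
import HarnessLib
import Summits.AnomalousDissipation.AnomalousDissipation.Theses.ResponseTelescope

/-!
# Birth skeleton (BC3) — crux `ResponseTelescope.HalvingCeiling` (stmt-AnomalousDissipation-2028)

Route `route-AnomalousDissipation-ResponseTelescope`, crux #2 (RESPONSE CEILING ACROSS ONE VISCOSITY
HALVING): for every smooth divergence-free mean-zero first-shell force `f` (`−Δf = 4π²f`) there are
`C ≥ 0`, `θ ∈ (0,1]` in the pinned clause `C(1/250)^θ ≤ (1−(3/4)^θ)/10` such that every time-periodic
classical solution `u` of `NS_ν(f)` on `ℝ × T³` in the scope `Ē > 0`, `β = Ī/Ē^{3/2} ≥ 1/20`,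
`r² = νĪ/Ē² ≤ (1/250)²` has a PARTNER periodic classical solution `u′` of `NS_{ν/2}(f)` with
`|Ē′ − Ē| ≤ C r^θ Ē`, `|Ī′ − Ī| ≤ C r^θ Ī` (`Ē = meanEnergy`, `Ī = meanDissipation ν`, `Ī′ = meanDissipation (ν/2)`).

This file is the route-level BIRTH CERTIFICATE skeleton of the crux (LENSES-v3 §2 BC3; registrar seat
`planner-skel-stmt-AnomalousDissipation-2028-0`, 2026-08-17, route re-audit bin REPAIRABLE). It types the
crux's own proof map (route header: "the partner is in general a DIFFERENT orbit whose existence … rests on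
density of UPO budgets in the budget set of invariant measures (Sigmund1970-type specification) and on that
set not receding faster than `C r^θ`") as TWO NAMED PIECES and a kernel-checked composition.

## The seam: RESPONSE (statistical stability, weakest realisability class) × CLOSING (periodic-orbit
budget density at fixed viscosity)

The route imports two literatures — statistical stability / response of long-time statistics in a
parameter (Ruelle2009, Wang2009, HairerMajda2009, CarigiKunaBrocker2024) and periodic-orbit theory of
turbulence (VanVeenKidaKawahara2006, ChandlerKerswell2013, Sigmund1970) — and the skeleton cuts the crux
exactly between them:

* `stub_halvingResponseState` (RESPONSE; the hardest, open). Statistical stability of the budget PAIR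
  across ONE halving, realised in the WEAKEST class: every in-scope periodic orbit `u` of `NS_ν(f)` admits
  a global classical solution `(v,q)` of `NS_{ν/2}(f)` on `[0,∞) × T³` whose running budget means CONVERGE
  (`HasSteadyBudgets (ν/2) v` — a statistically steady trajectory, so that `(Ē_v, Ī_v)` is an honest
  time-average pair and not two unrelated `limsup`s) with `|Ē_v − Ē| ≤ C₁ r^θ Ē`, `|Ī_v − Ī| ≤ C₁ r^θ Ī`,
  the constants `(C₁, θ)` lying STRICTLY inside the pinned clause, `C₁(1/250)^θ < (1−(3/4)^θ)/10` (the
  slack pays for the closing). No periodicity is asked of `v`: the tools of statistical stability (upper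
  semicontinuity of stationary statistical solutions in the parameter, Wang2009; response bounds; generic
  points of an ergodic component) deliver statistically steady states, never periodic orbits. NOT the crux
  reworded: the crux implies it only up to the strict clause (restrict the partner orbit to `[0,∞)`,
  `Torus.IsClassicalNSSolutionOn.mono`; its means converge, `tendsto_timeMean_atTop_of_periodic`), and it
  gives the crux back only THROUGH the closing stub (BC3 probes below).
* `stub_periodicBudgetClosing` (CLOSING; open — the periodic-orbit-theory hypothesis made precise, NO
  halving). At a FIXED viscosity `μ > 0`, the budget pair of every statistically steady global classical
  trajectory `(v,q)` of `NS_μ(f)` on `[0,∞) × T³` in the slightly widened high-Reynolds scope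
  `Ē_v > 0`, `β_v ≥ 1/40`, `μ Ī_v ≤ (1/250)² Ē_v²` lies in the CLOSURE of the periodic-orbit budget set:
  for every `ε > 0` there is a time-periodic classical solution `(u′,p′)` of `NS_μ(f)` on `ℝ × T³` with
  `|Ē′ − Ē_v| ≤ ε Ē_v`, `|Ī′ − Ī_v| ≤ ε Ī_v` (Sigmund-type density of periodic-orbit measures, known under
  specification and unknown for NS; steady states count, being `τ`-periodic for every `τ > 0`). The
  Reynolds ceiling is KEPT in the scope on purpose: closing with arbitrary precision is only plausible in
  the fully turbulent regime (at moderate `Re` an attracting quasi-periodic 2-torus would defeat it).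
* `HalvingCeiling_of : Sig.stub_halvingResponseState → Sig.stub_periodicBudgetClosing → HalvingCeiling` —
  the SORRY-FREE composition (axioms `propext`, `Classical.choice`, `Quot.sound`; ≈ 110 lines of real
  arithmetic, `Real.rpow`/`Real.sqrt`): constants `θ := θ₁`, `C := ((1−(3/4)^θ)/10)/(1/250)^θ` (the clause
  holds with equality; `C − C₁ > 0` by strictness); per orbit, with `ρ := (νĪ/Ē²)^{θ/2} ≤ (1/250)^θ`
  (`Real.rpow_le_rpow`, `rpow_two`, `rpow_mul`) and the one-step loss `x := C₁ρ < 1/10`: the response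
  partner `v` obeys `(1−x)Ē ≤ Ē_v ≤ (1+x)Ē`, `(1−x)Ī ≤ Ī_v ≤ (1+x)Ī`, hence sits in the closing scope at
  `μ = ν/2` — `Ē_v > 0`; `β_v`: `Ē_v√Ē_v ≤ (1+x)(21/20) Ē√Ē` (`√(1+x) ≤ 21/20`) and
  `(1/40)(1+x)(21/20) ≤ (1−x)/20`; `r_v`: `(ν/2)Ī_v ≤ ((1+x)/2)(1/250)²Ē² ≤ (1−x)²(1/250)²Ē² ≤ (1/250)²Ē_v²`
  (the halving only helps) — close it with precision `ε := (C − C₁)ρ/2` and add up: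
  `|Ē′ − Ē| ≤ εĒ_v + xĒ ≤ (C − C₁)ρĒ + C₁ρĒ = CρĒ`, the same for `Ī`.
* `HalvingCeiling_proof : HalvingCeiling` — the skeleton in its final shape (the crux BY NAME from the two
  registered stubs; depends on `sorryAx` through the stubs only).

Numerals: `1/40` is any drag floor `b < (1−x)(1+x)^{-3/2}/20` at `x = 1/10` (`b < 0.039`); the widened
scope is forced by the additive seam (a partner with budgets off by `x` has `β_v ≥ (1−x)(1+x)^{-3/2}β`),
and the STRICT clause in stub 1 is the minimal slack an additive closing error needs (exact budget matching
by a periodic orbit is not to be expected: periodic-orbit budgets should form a countable set).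

## Disproof used / negatives

No `Cruxes/HalvingCeiling/Disproof.lean` exists yet (`ledger crux ls stmt-AnomalousDissipation-2028`: no
workfiles, no crux ideas; no cdisprove cycle; dead lines: none — 2026-08-17). `ledger negatives --problem
AnomalousDissipation` (6 refuted statements, 2026-08-17): none equal or trivially equivalent to either stub.
Their two lessons — Galilean boosts / conserved non-zero mean momentum (`CorrelationEnergyUnboundedNeg_refuted`)
and mean-zero energy space vs arbitrary Leray–Hopf data (`FrustratedForcesEnsembleCeilingBridge_refuted`,
`FrustratedForcesGPEnergyCeiling_refuted`) — do not bite: both stubs quantify over classical solutions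
with exactly the crux's conventions (no mean-zero clause on `u`, `v`, `u′`; a partner may carry the orbit's
conserved mean momentum), and neither asserts an energy ceiling from data.

## BC3 audit (this seat; raw outputs under `birth-certificate:` in the seat's NOTES.md)

`lean check --json` rc 0 with `sorry` exactly in `stub_halvingResponseState`, `stub_periodicBudgetClosing`
(sorry count 2 = stub count, zero elsewhere); `#print axioms HalvingCeiling_of` = [propext, Classical.choice,
Quot.sound]. Probes, for `X ∈ {Sig.stub_halvingResponseState, Sig.stub_periodicBudgetClosing}`:
`example : X → HalvingCeiling` and `example : X → AnomalousDissipation` by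
`first | exact? | simpa [X] | (unfold X; simpa) | aesop`, by the plain `first | exact? | simpa | aesop`, and
in the `(h : X)` form by `first | exact? | simpa using h | aesop`, all under `maxHeartbeats 400000` — ALL 12
FAIL (4/4 required probes: `aesop` "failed to prove the goal after exhaustive search" resp. "made no
progress", `exact?`/`simpa` find nothing) — files `bc/probe_*.lean`, `bc/probe2_*.lean` of the seat folder.
No stub is cheaply the crux or the summit: stub 1 produces no periodic orbit, stub 2 knows no halving.

## References

* X. Wang, *Upper semi-continuity of stationary statistical properties of dissipative systems*, DCDS-A 23
  (2009), doi:10.3934/dcds.2009.23.521. [Wang2009]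
* D. Ruelle, *A review of linear response theory for general differentiable dynamical systems*,
  Nonlinearity 22 (2009), doi:10.1088/0951-7715/22/4/009. [Ruelle2009]
* M. Hairer, A. Majda, arXiv:0909.4313 (2009). [HairerMajda2009]
* K. Sigmund, *Generic properties of invariant measures for Axiom A diffeomorphisms*, Invent. Math. 11
  (1970), doi:10.1007/bf01404606. [Sigmund1970]
* L. van Veen, S. Kida, G. Kawahara, *Periodic motion representing isotropic turbulence*, arXiv:1804.00547
  (Fluid Dyn. Res. 38 (2006)), pp. 6–7. [VanVeenKidaKawahara2006]
* G. Chandler, R. Kerswell, J. Fluid Mech. 722 (2013). [ChandlerKerswell2013]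
* W. D. McComb et al., arXiv:1406.6317, p. 2, p. 10 (`C_ε = 0.468 + 18.9/R_L`). [MccombEtAl2015]
* C. Doering, C. Foias, J. Fluid Mech. 467 (2002) §2. [DoeringFoias2002]
-/

set_option linter.dupNamespace false

noncomputable section

namespace Summit.AnomalousDissipation.AnomalousDissipation.Cruxes.HalvingCeiling.Birth

open MeasureTheory Set Filter Topology Function
open Literature.Analysis.FunctionSpaces Literature.Analysis.FunctionSpaces.Torus
open Literature.Analysis.FluidPDE
open Summit.AnomalousDissipation.AnomalousDissipation.Theses.ResponseTelescope

/-- The physical flat unit torus `T³` (local notation). -/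
local notation "𝕋³" => UnitAddTorus (Fin 3)
/-- Velocity values (local notation). -/
local notation "E³" => EuclideanSpace ℝ (Fin 3)

/-! ### Vocabulary of the seam -/

/-- `HasSteadyBudgets μ v`: the trajectory `v` is STATISTICALLY STEADY for the two budgets at
viscosity `μ` — its running time means `T⁻¹∫₀ᵀ ‖v(t)‖₂² dt` and `T⁻¹∫₀ᵀ μ‖∇v(t)‖₂² dt` CONVERGE
(necessarily to `meanEnergy v` and `meanDissipation μ v`, which are their `limsup`s). Periodic
orbits have it (`Literature.Analysis.FluidPDE.tendsto_timeMean_atTop_of_periodic`); it is what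
makes `(meanEnergy v, meanDissipation μ v)` an honest time-average budget PAIR (one generalized
limit / one invariant measure generated by the trajectory), not two unrelated `limsup`s. -/
def HasSteadyBudgets (μ : ℝ) (v : ℝ → 𝕋³ → E³) : Prop :=
  Tendsto (timeMean fun t => ∫ x, ‖v t x‖ ^ 2) atTop (𝓝 (meanEnergy v)) ∧
    Tendsto (timeMean fun t => μ * (eGradNormSq (v t)).toReal) atTop
      (𝓝 (meanDissipation μ v))

/-! ### Stub signatures (`Sig.stub_*`; the hypothesis heads of `HalvingCeiling_of` carry the
registered stub names) -/

/-- STUB 1 — RESPONSE: STATISTICAL STABILITY OF THE TWO BUDGETS ACROSS ONE VISCOSITY HALVING,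
REALISED IN THE WEAKEST CLASS (a statistically steady global classical trajectory of
`NS_{ν/2}(f)`, NOT a periodic orbit). For every first-shell force `f` there are `C₁ ≥ 0`,
`θ ∈ (0,1]` STRICTLY inside the pinned clause, `C₁(1/250)^θ < (1−(3/4)^θ)/10`, such that every
in-scope periodic orbit `u` of `NS_ν(f)` (`Ē > 0`, `β ≥ 1/20`, `r ≤ 1/250`) admits a global
classical solution `(v,q)` of `NS_{ν/2}(f)` on `[0,∞) × T³` with convergent budget means and
`|Ē_v − Ē| ≤ C₁ r^θ Ē`, `|Ī_v − Ī| ≤ C₁ r^θ Ī` (`Ī_v = meanDissipation (ν/2) v`). -/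
def Sig.stub_halvingResponseState : Prop :=
  ∀ f : 𝕋³ → E³, IsSmooth f → IsDivFree f → HasZeroMean f →
    (∀ x, laplacian f x = -((4 * Real.pi ^ 2) • f x)) →
    ∃ C₁ θ : ℝ, 0 ≤ C₁ ∧ 0 < θ ∧ θ ≤ 1 ∧
      C₁ * (1 / 250 : ℝ) ^ θ < (1 - (3 / 4 : ℝ) ^ θ) / 10 ∧
      ∀ (ν τ : ℝ) (u : ℝ → 𝕋³ → E³) (p : ℝ → 𝕋³ → ℝ), 0 < ν → 0 < τ → Periodic u τ →
        IsClassicalNSSolutionOn univ ν (fun _ => f) u p →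
        0 < meanEnergy u →
        (1 / 20 : ℝ) * (meanEnergy u * Real.sqrt (meanEnergy u)) ≤ meanDissipation ν u →
        ν * meanDissipation ν u ≤ (1 / 250 : ℝ) ^ 2 * meanEnergy u ^ 2 →
        ∃ (v : ℝ → 𝕋³ → E³) (q : ℝ → 𝕋³ → ℝ),
          IsClassicalNSSolutionOn (Ici 0) (ν / 2) (fun _ => f) v q ∧
          HasSteadyBudgets (ν / 2) v ∧
          |meanEnergy v - meanEnergy u| ≤
            C₁ * (ν * meanDissipation ν u / meanEnergy u ^ 2) ^ (θ / 2) * meanEnergy u ∧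
          |meanDissipation (ν / 2) v - meanDissipation ν u| ≤
            C₁ * (ν * meanDissipation ν u / meanEnergy u ^ 2) ^ (θ / 2) * meanDissipation ν u

/-- STUB 2 — CLOSING: PERIODIC-ORBIT BUDGETS ARE DENSE AT THE BUDGETS OF STATISTICALLY STEADY
HIGH-REYNOLDS TRAJECTORIES (fixed viscosity; no halving). For every first-shell force `f`, every
viscosity `μ > 0`, every global classical solution `(v,q)` of `NS_μ(f)` on `[0,∞) × T³` with
convergent budget means in the (slightly widened) scope `Ē_v > 0`, `β_v ≥ 1/40`, `r_v ≤ 1/250`,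
and every `ε > 0`, there is a time-periodic classical solution `(u′,p′)` of `NS_μ(f)` on `ℝ × T³`
with `|Ē′ − Ē_v| ≤ ε Ē_v` and `|Ī′ − Ī_v| ≤ ε Ī_v`. -/
def Sig.stub_periodicBudgetClosing : Prop :=
  ∀ f : 𝕋³ → E³, IsSmooth f → IsDivFree f → HasZeroMean f →
    (∀ x, laplacian f x = -((4 * Real.pi ^ 2) • f x)) →
    ∀ (μ : ℝ) (v : ℝ → 𝕋³ → E³) (q : ℝ → 𝕋³ → ℝ), 0 < μ →
      IsClassicalNSSolutionOn (Ici 0) μ (fun _ => f) v q → HasSteadyBudgets μ v →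
      0 < meanEnergy v →
      (1 / 40 : ℝ) * (meanEnergy v * Real.sqrt (meanEnergy v)) ≤ meanDissipation μ v →
      μ * meanDissipation μ v ≤ (1 / 250 : ℝ) ^ 2 * meanEnergy v ^ 2 →
      ∀ ε : ℝ, 0 < ε →
        ∃ (τ' : ℝ) (u' : ℝ → 𝕋³ → E³) (p' : ℝ → 𝕋³ → ℝ), 0 < τ' ∧ Periodic u' τ' ∧
          IsClassicalNSSolutionOn univ μ (fun _ => f) u' p' ∧
          |meanEnergy u' - meanEnergy v| ≤ ε * meanEnergy v ∧
          |meanDissipation μ u' - meanDissipation μ v| ≤ ε * meanDissipation μ v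

/-! ### Registered stubs -/

/-- Registered stub 1 — RESPONSE across one halving, realised by a statistically steady trajectory of
`NS_{ν/2}(f)` (load-bearing, hardest; open: the finite-Reynolds-number law of `C_ε` as a theorem,
MccombEtAl2015 / Wang2009 made quantitative). -/
theorem stub_halvingResponseState : Sig.stub_halvingResponseState := by
  sorry

/-- Registered stub 2 — CLOSING: periodic-orbit budgets are dense at the budgets of statistically steady
high-Reynolds trajectories, at fixed viscosity (open: Sigmund-type density without specification). -/
theorem stub_periodicBudgetClosing : Sig.stub_periodicBudgetClosing := by
  sorry

/-! ### Composition -/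

/-- **The line closes the crux BY NAME modulo the two registered stubs** (sorry-free; the implication
content of the skeleton). From stub 1 take `(C₁, θ)` strictly inside the clause and set
`C := ((1−(3/4)^θ)/10)/(1/250)^θ`; for an in-scope orbit `u` take the statistically steady partner `v`
of `NS_{ν/2}(f)` (loss `x = C₁ r^θ < 1/10`), check that `v` lies in the closing scope at `μ = ν/2`
(`β_v ≥ 1/40`, `r_v ≤ r ≤ 1/250`), close it by a periodic orbit with relative precision `(C − C₁) r^θ/2`,
and add the two errors. -/
theorem HalvingCeiling_of :
    Sig.stub_halvingResponseState → Sig.stub_periodicBudgetClosing → HalvingCeiling := by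
  intro hS1 hS2 f hf hdiv hmean hshell
  obtain ⟨C₁, θ, hC₁, hθ, hθ1, hlt, hstep⟩ := hS1 f hf hdiv hmean hshell
  -- the constants of the ceiling: `a := (1/250)^θ`, `C := ((1 - (3/4)^θ)/10) / a`
  have ha : 0 < (1 / 250 : ℝ) ^ θ := Real.rpow_pos_of_pos (by norm_num) θ
  have hq0 : 0 ≤ (3 / 4 : ℝ) ^ θ := Real.rpow_nonneg (by norm_num) θ
  have hq1 : (3 / 4 : ℝ) ^ θ ≤ 1 := Real.rpow_le_one (by norm_num) (by norm_num) hθ.le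
  set a : ℝ := (1 / 250 : ℝ) ^ θ with ha_def
  set C : ℝ := (1 - (3 / 4 : ℝ) ^ θ) / 10 / a with hC_def
  have hCa : C * a = (1 - (3 / 4 : ℝ) ^ θ) / 10 := by
    rw [hC_def]; field_simp
  have hC₁C : C₁ < C := by
    rw [hC_def, lt_div_iff₀ ha]; exact hlt
  have hC0 : 0 ≤ C := hC₁.trans hC₁C.le
  refine ⟨C, θ, hC0, hθ, hθ1, le_of_eq hCa, ?_⟩
  intro ν τ u p hν hτ hper hsol hE hβ hr
  obtain ⟨v, q, hv, hsteady, hEv, hIv⟩ := hstep ν τ u p hν hτ hper hsol hE hβ hr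
  -- abbreviations: the four budgets and the modulus `ρ = r^θ = (νĪ/Ē²)^{θ/2}`
  set E : ℝ := meanEnergy u with hE_def
  set I : ℝ := meanDissipation ν u with hI_def
  set Ev : ℝ := meanEnergy v with hEv_def
  set Iv : ℝ := meanDissipation (ν / 2) v with hIv_def
  set ρ : ℝ := (ν * I / E ^ 2) ^ (θ / 2) with hρ_def
  set x : ℝ := C₁ * ρ with hx_def
  clear_value x ρ Ev Iv I E
  -- positivity and `ρ ≤ a`
  have hsqrtE : 0 < Real.sqrt E := Real.sqrt_pos.mpr hE
  have hEs : 0 < E * Real.sqrt E := mul_pos hE hsqrtE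
  have hI : 0 < I := lt_of_lt_of_le (by positivity) hβ
  have hratio_pos : 0 < ν * I / E ^ 2 := by positivity
  have hρ : 0 < ρ := hρ_def ▸ Real.rpow_pos_of_pos hratio_pos _
  have hratio_le : ν * I / E ^ 2 ≤ (1 / 250 : ℝ) ^ 2 := by
    rw [div_le_iff₀ (by positivity)]; exact hr
  have hρa : ρ ≤ a := by
    have h1 : ρ ≤ ((1 / 250 : ℝ) ^ 2) ^ (θ / 2) :=
      hρ_def ▸ Real.rpow_le_rpow hratio_pos.le hratio_le (by linarith)
    have h2 : ((1 / 250 : ℝ) ^ 2) ^ (θ / 2) = a := by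
      rw [ha_def, ← Real.rpow_two, ← Real.rpow_mul (by norm_num : (0 : ℝ) ≤ 1 / 250),
        show (2 : ℝ) * (θ / 2) = θ by ring]
    exact h2 ▸ h1
  -- the one-step loss `x = C₁ ρ < 1/10`
  have hx0 : 0 ≤ x := hx_def ▸ mul_nonneg hC₁ hρ.le
  have hx1 : x < 1 / 10 := by
    calc x = C₁ * ρ := hx_def
      _ ≤ C₁ * a := mul_le_mul_of_nonneg_left hρa hC₁
      _ < (1 - (3 / 4 : ℝ) ^ θ) / 10 := hlt
      _ ≤ 1 / 10 := by linarith [hq0]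
  -- two-sided budget control of the statistically steady partner `v`
  have hEv_lo : (1 - x) * E ≤ Ev := by have := (abs_le.mp hEv).1; linarith
  have hEv_hi : Ev ≤ (1 + x) * E := by have := (abs_le.mp hEv).2; linarith
  have hIv_lo : (1 - x) * I ≤ Iv := by have := (abs_le.mp hIv).1; linarith
  have hIv_hi : Iv ≤ (1 + x) * I := by have := (abs_le.mp hIv).2; linarith
  -- `v` is in the closing stub's scope at viscosity `ν/2`: (a) positive energy
  have h1x : 0 < 1 - x := by linarith
  have hEv_pos : 0 < Ev := lt_of_lt_of_le (mul_pos h1x hE) hEv_lo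
  -- (b) drag floor `β_v ≥ 1/40`
  have hsqrt_Ev : Real.sqrt Ev ≤ (21 / 20) * Real.sqrt E := by
    have h1 : Real.sqrt Ev ≤ Real.sqrt ((1 + x) * E) := Real.sqrt_le_sqrt hEv_hi
    have h2 : Real.sqrt ((1 + x) * E) = Real.sqrt (1 + x) * Real.sqrt E :=
      Real.sqrt_mul (by linarith) E
    have h3 : Real.sqrt (1 + x) ≤ 21 / 20 := by
      calc Real.sqrt (1 + x) ≤ Real.sqrt ((21 / 20 : ℝ) ^ 2) :=
            Real.sqrt_le_sqrt (by norm_num; linarith)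
        _ = 21 / 20 := Real.sqrt_sq (by norm_num)
    calc Real.sqrt Ev ≤ Real.sqrt (1 + x) * Real.sqrt E := h1.trans_eq h2
      _ ≤ (21 / 20) * Real.sqrt E := mul_le_mul_of_nonneg_right h3 hsqrtE.le
  have hβv : (1 / 40 : ℝ) * (Ev * Real.sqrt Ev) ≤ Iv := by
    have h1 : Ev * Real.sqrt Ev ≤ ((1 + x) * E) * ((21 / 20) * Real.sqrt E) :=
      mul_le_mul hEv_hi hsqrt_Ev (Real.sqrt_nonneg _) (by positivity)
    have h2 : (1 - x) * ((1 / 20 : ℝ) * (E * Real.sqrt E)) ≤ Iv :=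
      le_trans (mul_le_mul_of_nonneg_left hβ h1x.le) hIv_lo
    have h3 : (1 / 40 : ℝ) * ((1 + x) * (21 / 20)) ≤ (1 - x) * (1 / 20) := by linarith
    calc (1 / 40 : ℝ) * (Ev * Real.sqrt Ev)
        ≤ (1 / 40 : ℝ) * (((1 + x) * E) * ((21 / 20) * Real.sqrt E)) :=
          mul_le_mul_of_nonneg_left h1 (by norm_num)
      _ = (1 / 40 : ℝ) * ((1 + x) * (21 / 20)) * (E * Real.sqrt E) := by ring
      _ ≤ (1 - x) * (1 / 20) * (E * Real.sqrt E) := mul_le_mul_of_nonneg_right h3 hEs.le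
      _ = (1 - x) * ((1 / 20 : ℝ) * (E * Real.sqrt E)) := by ring
      _ ≤ Iv := h2
  -- (c) Reynolds ceiling `r_v ≤ 1/250` (the halving only helps)
  have hrv : ν / 2 * Iv ≤ (1 / 250 : ℝ) ^ 2 * Ev ^ 2 := by
    have h1 : ν / 2 * Iv ≤ (1 + x) / 2 * ((1 / 250 : ℝ) ^ 2 * E ^ 2) := by
      calc ν / 2 * Iv ≤ ν / 2 * ((1 + x) * I) := mul_le_mul_of_nonneg_left hIv_hi (by positivity)
        _ = (1 + x) / 2 * (ν * I) := by ring
        _ ≤ (1 + x) / 2 * ((1 / 250 : ℝ) ^ 2 * E ^ 2) :=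
          mul_le_mul_of_nonneg_left hr (by linarith)
    have h2 : ((1 - x) * E) * ((1 - x) * E) ≤ Ev * Ev :=
      mul_self_le_mul_self (mul_pos h1x hE).le hEv_lo
    have h3 : (1 + x) / 2 ≤ (1 - x) ^ 2 := by nlinarith [sq_nonneg x]
    calc ν / 2 * Iv ≤ (1 + x) / 2 * ((1 / 250 : ℝ) ^ 2 * E ^ 2) := h1
      _ ≤ (1 - x) ^ 2 * ((1 / 250 : ℝ) ^ 2 * E ^ 2) :=
          mul_le_mul_of_nonneg_right h3 (by positivity)
      _ = (1 / 250 : ℝ) ^ 2 * (((1 - x) * E) * ((1 - x) * E)) := by ring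
      _ ≤ (1 / 250 : ℝ) ^ 2 * (Ev * Ev) := mul_le_mul_of_nonneg_left h2 (by norm_num)
      _ = (1 / 250 : ℝ) ^ 2 * Ev ^ 2 := by ring
  -- close the statistically steady partner by a periodic orbit, precision `(C - C₁) ρ / 2`
  have hD : 0 < C - C₁ := sub_pos.mpr hC₁C
  have hε : 0 < (C - C₁) * ρ / 2 := by positivity
  obtain ⟨τ', u', p', hτ', hper', hsol', hE', hI'⟩ :=
    hS2 f hf hdiv hmean hshell (ν / 2) v q (by positivity) hv hsteady
      (by rw [← hEv_def]; exact hEv_pos) (by rw [← hEv_def, ← hIv_def]; exact hβv)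
      (by rw [← hEv_def, ← hIv_def]; exact hrv) ((C - C₁) * ρ / 2) hε
  rw [← hEv_def] at hE'
  rw [← hIv_def] at hI'
  have hxE : x * E ≤ 1 * E := mul_le_mul_of_nonneg_right (by linarith) hE.le
  have hxI : x * I ≤ 1 * I := mul_le_mul_of_nonneg_right (by linarith) hI.le
  have hEv2 : Ev ≤ 2 * E := by linarith
  have hIv2 : Iv ≤ 2 * I := by linarith
  refine ⟨τ', u', p', hτ', hper', hsol', ?_, ?_⟩
  · calc |meanEnergy u' - E| ≤ |meanEnergy u' - Ev| + |Ev - E| := abs_sub_le _ _ _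
      _ ≤ (C - C₁) * ρ / 2 * Ev + x * E := add_le_add hE' hEv
      _ ≤ (C - C₁) * ρ / 2 * (2 * E) + x * E :=
          add_le_add (mul_le_mul_of_nonneg_left hEv2 hε.le) le_rfl
      _ = C * ρ * E := by rw [hx_def]; ring
  · calc |meanDissipation (ν / 2) u' - I|
        ≤ |meanDissipation (ν / 2) u' - Iv| + |Iv - I| := abs_sub_le _ _ _
      _ ≤ (C - C₁) * ρ / 2 * Iv + x * I := add_le_add hI' hIv
      _ ≤ (C - C₁) * ρ / 2 * (2 * I) + x * I :=
          add_le_add (mul_le_mul_of_nonneg_left hIv2 hε.le) le_rfl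
      _ = C * ρ * I := by rw [hx_def]; ring

/-- The skeleton in its final shape (D-0027 §3.3): the crux BY NAME from the two registered stubs;
it becomes the crux proof when the last `stub_*` is discharged (until then it depends on `sorryAx`
through the stubs only — no `sorry` of its own). -/
theorem HalvingCeiling_proof : HalvingCeiling :=
  HalvingCeiling_of stub_halvingResponseState stub_periodicBudgetClosing

end Summit.AnomalousDissipation.AnomalousDissipation.Cruxes.HalvingCeiling.Birth

end
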